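import Summits.BirchSwinnertonDyer.BirchSwinnertonDyer.Theses.UniversalToricDescent

/-!
# RK-6 (pen bsd-wall-pss3x g8) — re-key of the deciding chain of route UniversalToricDescent to accept the
# RATIONAL wall (inclusion up to a power of 3) — TYPED PROPOSAL, not applied (utd-p1 g19 FINDING 07:02:04Z).

Items as they would be rendered (texts verbatim from rev 79 d7687326f5e2 except the marked deltas):
* NEW crux `RationalSplitIMCInclusionAtThree` = 20395's binders VERBATIM, conclusion `∃ k, 3^k·L ∈ Ch·R₀⟦T⟧`
  (the membership shape consumed by `…RatwallThinComb.stub_ratSqueeze` p703763 / `stub_ratDescent` p703976);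
* RESTATED package hP 26976 `ToricDefectWallMuAtThree` := ♭T≤ ∧ (WALL ∨ RATWALL) ∧ μ_twin (the wall stays text-nested = in cone,
  and stays a SUFFICIENT road: `rationalSplitIMCInclusionAtThree_of_wall` below, k = 0);
* NEW support kernel⁶ `ToricKernelAtThreeApZeroOddDegreeOfPrintRat` = kernel⁵ 22543's text with the wall binder replaced by
  the disjunction (prover: `rintro hF hD (hw | hr) hμ …`, reduce `hw` to `hr` by the k = 0 lemma, then the wall-free chain:
  μ(X_E) = 0 + Λ-torsion from the twin (`…TorsionMuTransportHeegner.torsionMuTransportModThree`), squeeze `stub_ratSqueeze`,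
  ♭T≤ one-sided inequality, twin IMC);
* `closes` re-keyed: binders hP : hP′, hK : kernel⁶; proof term unchanged.
-/

namespace Summit.BirchSwinnertonDyer.BirchSwinnertonDyer.Theses.UniversalToricDescent

/-- [crux · RATIONAL WALL] -/
def RationalSplitIMCInclusionAtThree : Prop :=
  ∀ (W : WeierstrassCurve ℚ) [W.IsElliptic] [W.IsGloballyMinimal] (N : ℕ) [NeZero N] (K : Type) [Field K] [NumberField K] (Dt : Literature.NumberTheory.EllipticCurves.ModularForms.ModularParametrizationData W N), Summit.BirchSwinnertonDyer.Rank1Residual.Additive.ClassO6 W 3 → W.HasSurjectiveModNGaloisRep 3 → W.analyticRank = 1 → W.conductorNorm ℤ = N → Literature.NumberTheory.EllipticCurves.IsImaginaryQuadratic K → Literature.NumberTheory.EllipticCurves.SatisfiesHeegnerHypothesis N K → ∀ (κ : Literature.NumberTheory.EllipticCurves.ZpExtension K 3), κ.IsAnticyclotomic → ∀ (γ : Field.absoluteGaloisGroup K) [Fact (κ.IsTopGenerator γ)] (𝔭 : IsDedekindDomain.HeightOneSpectrum (NumberField.RingOfIntegers K)), ((3 : ℕ) : NumberField.RingOfIntegers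 K) ∈ 𝔭.asIdeal → 𝔭.asIdeal.ramificationIdx (NumberField.RingOfIntegers ℚ) = 1 → 𝔭.asIdeal.inertiaDeg (NumberField.RingOfIntegers ℚ) = 1 → ∀ (𝔭' : IsDedekindDomain.HeightOneSpectrum (NumberField.RingOfIntegers K)), ((3 : ℕ) : NumberField.RingOfIntegers K) ∈ 𝔭'.asIdeal → 𝔭' ≠ 𝔭 → ∀ (ι' : PadicAlgCl 3 ≃+* ℂ), Summit.BirchSwinnertonDyer.BirchSwinnertonDyer.Theorems.SchneiderFree.BranchInducesPrime 3 ι' 𝔭 → ∀ (ΩK : ℂ) (Ωp : ℂ_[3]) (L : Literature.NumberTheory.EllipticCurves.UnrSeries 3), ΩK ≠ 0 → Ωp ≠ 0 → Literature.NumberTheory.EllipticCurves.IsBDPLFunction ι' 𝔭 κ γ Dt.f ΩK Ωp L → ∃ k : ℕ, ((3 : ℕ) : Literature.NumberTheory.EllipticCurves.UnrSeries 3) ^ k * L ∈ (Summit.BirchSwinnertonDyer.Rank1Residual.X11b.AcSelmer.XAc.charIdeal (W.baseChange K) 3 κ 𝔭' ∅ γ).map (PowerSeries.map (Summit.BirchSwinnertonDyer.Rank1Residual.X11b.Halves.toUnr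 3))

/-- [support · package hP′ — would be the restated text of 26976 `ToricDefectWallMuAtThree`] -/
def ToricDefectWallMuAtThreeRK6 : Prop :=
  DefectTransportModThreePT ∧ (AdditiveSplitIMCInclusionAtThree ∨ RationalSplitIMCInclusionAtThree) ∧ TwinMuZeroAtThree

/-- [support · kernel⁶] -/
def ToricKernelAtThreeApZeroOddDegreeOfPrintRat : Prop :=
  ToricPublishedInputs → DefectTransportModThreePT → (AdditiveSplitIMCInclusionAtThree ∨ RationalSplitIMCInclusionAtThree) → TwinMuZeroAtThree → TwinDegreeFrameAtThreeMultTresT ∧ TwinDegreeFrameAtThreeGoodSSApZeroT → GoodSSApZeroTwinSupplyAtThree → PeuRamifieMultTwinResupplyAtThree → WildSplitPrintedInputsAtThree → WildSplitFrameAtThreeOddOfPrint → ToricPrintedLeavesAtThree → WildRankZeroTwistAtThree → ∀ (W : WeierstrassCurve ℚ) [W.IsElliptic] [W.IsGloballyMinimal], Summit.BirchSwinnertonDyer.Rank1Residual.Additive.ClassO6 W 3 → W.analyticRank = 1 → W.HasSurjectiveModNGaloisRep 3 → (∃ (W' : WeierstrassCurve ℚ) (_ : W'.IsElliptic) (_ :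 W'.IsGloballyMinimal), Summit.BirchSwinnertonDyer.Rank1Residual.O6.ModPCongruent W' W 3 ∧ ¬ Literature.NumberTheory.EllipticCurves.Rank1Residual.Addv W' 3 ∧ W'.HasSurjectiveModNGaloisRep 3) → Literature.NumberTheory.EllipticCurves.BSDp W 3

/-- the integral wall is the k = 0 case of the rational wall (cert that 20395 stays a sufficient road). -/
theorem rationalSplitIMCInclusionAtThree_of_wall :
    AdditiveSplitIMCInclusionAtThree → RationalSplitIMCInclusionAtThree := by
  intro hw W _ _ N _ K _ _ Dt hO6 hsurj hrk hN hK hH κ hκ γ _ 𝔭 h3 hram hdeg 𝔭' h3' hne ι' hι ΩK Ωp L hΩK hΩp hL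
  have h := hw W N K Dt hO6 hsurj hrk hN hK hH κ hκ γ 𝔭 h3 hram hdeg 𝔭' h3' hne ι' hι ΩK Ωp L hΩK hΩp hL
  rw [Ideal.span_singleton_le_iff_mem] at h
  exact ⟨0, by simpa using h⟩

/-- kernel⁵ (landed, 22543 ✓) is the `Or.inl` case of kernel⁶ up to the wall-free re-proof: nothing proved is lost. -/
example (h6 : ToricKernelAtThreeApZeroOddDegreeOfPrintRat) : ToricKernelAtThreeApZeroOddDegreeOfPrint :=
  fun hF hD hw hμ ↦ h6 hF hD (Or.inl hw) hμ

namespace RK6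
theorem closes (hF : ToricPublishedInputs) (hP : ToricDefectWallMuAtThreeRK6) (hB : TwinDegreeFrameAtThreeMultTresT)
    (hC : TwinDegreeFrameAtThreeGoodSSApZeroT) (hsupply : GoodSSApZeroTwinSupplyAtThree) (hR : PeuRamifieMultTwinResupplyAtThree)
    (hW : WildSplitPrintedInputsAtThree) (hS : WildSplitFrameAtThreeOddOfPrint) (hL : ToricPrintedLeavesAtThree)
    (hZ : WildRankZeroTwistAtThree) (hK : ToricKernelAtThreeApZeroOddDegreeOfPrintRat) :
    Summit.BirchSwinnertonDyer.WAllExclAddWildRankOneSurjTwin :=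
  Summit.BirchSwinnertonDyer.wAllExclAddWildRankOneSurjTwin_of_forall (hK hF hP.1 hP.2.1 hP.2.2 ⟨hB, hC⟩ hsupply hR hW hS hL hZ)
end RK6

end Summit.BirchSwinnertonDyer.BirchSwinnertonDyer.Theses.UniversalToricDescent
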